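import Summits.BirchSwinnertonDyer.BirchSwinnertonDyer.Theorems.CumulativeHeegnerLeopoldtRedSplitControlAtThree
import HarnessLib

/-!
# Crux K4 `RedSplitControlAtThree` (stmt-BirchSwinnertonDyer-24200) of route `CumulativeHeegnerLeopoldt`
# — LINE `birth`, skeleton v2 (width prover bsd-line-chl-p2 g0; supersedes v1 = pss3 g10 BC3 / chl-p1 g0
# sha16 eca442c504b1c936 with stubs `stub_charValuationExists` / `stub_controlFormula`)

v1 split the crux into its own ∃-half (A: `X_(∅,0)` torsion with a characteristic valuation at 𝟙) and
its formula half (B); both are the crux restated (B ⟸ A by `HasCharValuationAt.unique`), so v1 did not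
lower the difficulty. v2 records what is ACTUALLY left after the landed tree theorems:

* the E(K)[3] = 0 input of the K1 door on the reducible non-anomalous cell is the UNCONDITIONAL tree lemma
  `RedSplitControlAtThreeTorsionFree.forall_nsmul_eq_zero_of_nonAnomalousCell_of_isImaginaryQuadratic`
  (p596549);
* the crux BY NAME is `RedSplitControlAtThreeOfFacts.redSplitControlAtThree_of_poitouTate hPT hPT2`
  (Jetchev–Skinner–Wan control at the potentially supersingular split 3 via
  `AdditivePotSupersingularControl.additiveControlOnTreeAt_of_classO6_of_facts`, five of whose seven
  published-fact inputs are tree theorems);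
* so the ONLY open stubs are the two POITOU–TATE named facts — by name the leaves
  `PoitouTateSelmerStructureDualityFact` (stmt-BirchSwinnertonDyer-20461) and `PoitouTateShaTateDualFact`
  (stmt-BirchSwinnertonDyer-20462) of route `UniversalToricDescent` (shared with K1 ControlFacts 19538).

`RedSplitControlAtThree_of` concludes the route decl BY NAME from the two stubs. Sorries only in `stub_*`.
BSD is not proved by any of this.
-/

set_option linter.dupNamespace false
set_option autoImplicit false

noncomputable section

namespace Summit.BirchSwinnertonDyer.BirchSwinnertonDyer.Cruxes.RedSplitControlAtThree.Birth

/-- STUB PT1 (named published fact, NOT provable inside this line; = UTD leaf 20461): Poitou–Tate duality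
for Selmer structures over every number field (Milne ADT I 4.10(b); Rubin ES 1.7.3). -/
theorem stub_poitouTateSelmerStructureDuality :
    ∀ (K : Type) [Field K] [NumberField K],
      Literature.NumberTheory.GaloisCohomology.poitouTate_selmerStructure_duality K := by
  sorry

/-- STUB PT2 (named published fact, NOT provable inside this line; = UTD leaf 20462): the
Cassels–Poitou–Tate duality `Ш¹(T) ≃ Ш²(T^D)^∨` over every number field (Milne ADT I 4.10(a)). -/
theorem stub_poitouTateShaTateDual :
    ∀ (K : Type) [Field K] [NumberField K],
      Literature.NumberTheory.GaloisCohomology.poitouTate_sha_tateDual K := by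
  sorry

/-- COMPOSITION (line `birth` v2, kernel-checked): PT1 → PT2 ⟹ the route crux `RedSplitControlAtThree`
BY NAME (`redSplitControlAtThree_of_poitouTate`: E(K)[3] = 0 from the non-anomalous line + the K1 door at
the wild potentially supersingular 3 + the five landed fact theorems). -/
theorem RedSplitControlAtThree_of :
    Summit.BirchSwinnertonDyer.BirchSwinnertonDyer.Theses.CumulativeHeegnerLeopoldt.RedSplitControlAtThree :=
  Summit.BirchSwinnertonDyer.BirchSwinnertonDyer.Theorems.RedSplitControlAtThreeOfFacts.redSplitControlAtThree_of_poitouTate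
    stub_poitouTateSelmerStructureDuality stub_poitouTateShaTateDual

end Summit.BirchSwinnertonDyer.BirchSwinnertonDyer.Cruxes.RedSplitControlAtThree.Birth

end
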